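import Literature.Analysis.FluidPDE.PassiveVectorTensorUniqueness
import Mathlib.Analysis.SpecialFunctions.Exponential
import Mathlib.Analysis.InnerProductSpace.Calculus
import HarnessLib

/-!
# The MODAL ADJOINT COEFFICIENT CURVE of the constant-tensor passive-vector operator at one wave vector

Analysis/FluidPDE support file (definitions + proved lemmas; no named facts).  For a constant fourth-order
viscosity tensor `𝔸 : Visc4 d` (Frisch's eddy-viscosity tensor (9.57)) and an integer wave vector `k ≠ 0`,
plane waves `Re(e_k • z)` are mapped by the formal adjoint `𝓛_𝔸^*` to plane waves `Re(e_k • (−4π²) T_𝔸(k) z)`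
(`viscAdj_realTrigPoly_singleton`, `symbT`).  The Leray-projected modal generator
`L_k := 4π² · P_k ∘ T_𝔸(k)` (`P_k z = z − (k·z/|k|²) k` the transversal projection) therefore governs the
single-mode solutions of the BACKWARD ADJOINT problem `∂_τ φ + 𝓛_𝔸^* φ = ∇q`, `∇·φ = 0`: with
`c(τ) := exp((τ − t) L_k) z` one has `c′ = L_k c`, `k · c ≡ 0` when `k · z = 0`, and, in a Legendre–Hadamard
window `NearIso 𝔸 lo hi` with `lo ≥ 0`, the backward energy decay `‖c τ‖² ≤ e^{−8π² lo |k|² (t − τ)} ‖z‖²`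
(`τ ≤ t`) together with the dissipation identity `‖c t‖² − ‖c τ₀‖² = 8π² ∫_{τ₀}^{t} Re⟪c, T_𝔸(k) c⟫`.
This is the finite-dimensional (one Fourier mode) form of the adjoint parabolic problem used in
transposition / duality arguments (Lions–Magenes, Ch. 3 §4.3; Temam 1984, Ch. III §1.1 for the Fourier
characterisation of solenoidal fields `k · û_k = 0`); the space–time FIELD `Re(e_k • c τ)` and its
test-class properties are in `PassiveVectorTensorModalAdjointField`.

Consumer: cell `ad-ideate`, K1L_D `stmt-AnomalousDissipation-27980`, S23‴ sub-stub W3 (frame-level modal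
tracking by form-perturbation duality, tenure D25-3): the admissible distorted tests are `(∇X) • φ` with
`φ` such a modal adjoint field.

## Mathlib / tree search
Tree: `Torus.symbT` (+ `symbT_add/smul`, `continuous_symbT`), `lo_mul_le_re_inner_symbT`, `re_inner_symbT_eq`
(`PassiveVectorTensorFourier/Uniqueness/ModeEnergy`), `mem_orthogonal_waveVec_iff`; no modal generator / adjoint
curve existed (`rg "transversalProj|modalAdj" Literature`: nothing).  Mathlib: `NormedSpace.exp`,
`hasDerivAt_exp_smul_const` (real time in the `ℝ`-algebra `E →L[ℂ] E` via `NormedAlgebra.complexToReal`),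
`HasDerivAt.norm_sq`, `is_const_of_deriv_eq_zero`, `monotoneOn_of_deriv_nonneg`/`image_le_of_deriv_right_le_deriv_boundary`.

## References
* J.-L. Lions, E. Magenes, *Non-Homogeneous Boundary Value Problems* I (Springer 1972), Ch. 3 §4.3 (adjoint
  problem in transposition). [`LionsMagenes1972`]
* R. Temam, *Navier–Stokes Equations* (AMS Chelsea 1984/2001), Ch. III §1.1 (Fourier characterisation of
  solenoidal periodic fields). [`Temam1984`]
* U. Frisch, *Turbulence* (CUP 1995), §9.6.3 eq. (9.57) p. 233 (the eddy-viscosity tensor and its plane-wave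
  symbol). [`Frisch1995Turbulence`]
-/

noncomputable section

open MeasureTheory Set Filter Complex
open scoped InnerProductSpace ComplexConjugate NNReal

namespace Literature.Analysis.FluidPDE

namespace Torus

variable {d : Type*} [Fintype d] [DecidableEq d]

/-! ## §1 The transversal projection and the modal adjoint generator -/

omit [DecidableEq d] in
/-- `|k|² > 0` for `k ≠ 0`. [cite: Temam1984, Ch. III §1.1] -/
theorem freqNormSq_pos_of_ne_zero' {k : d → ℤ} (hk : k ≠ 0) : 0 < FunctionSpaces.Torus.freqNormSq k := by
  obtain ⟨i, hi⟩ : ∃ i, k i ≠ 0 := by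
    by_contra h
    push Not at h
    exact hk (funext h)
  have h1 : (0 : ℝ) < (k i : ℝ) ^ 2 := by
    have : (k i : ℝ) ≠ 0 := by exact_mod_cast hi
    positivity
  exact lt_of_lt_of_le h1 (Finset.single_le_sum (f := fun j => (k j : ℝ) ^ 2) (fun j _ => sq_nonneg _) (Finset.mem_univ i))

/-- The integer wave vector `k` as a vector of `ℂ^d`. [cite: Temam1984, Ch. III §1.1] -/
def waveVecC (k : d → ℤ) : EuclideanSpace ℂ d := WithLp.toLp 2 fun j => (k j : ℂ)

omit [Fintype d] [DecidableEq d] in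
/-- Coordinates of `waveVecC`. [cite: Temam1984, Ch. III §1.1] -/
@[simp] theorem waveVecC_apply (k : d → ℤ) (j : d) : waveVecC k j = (k j : ℂ) := rfl

/-- The Fourier-side divergence pairing `k · z = Σⱼ kⱼ zⱼ` (the quantity whose vanishing is the solenoidal
condition `k · û_k = 0`), as a `ℂ`-linear functional. [cite: Temam1984, Ch. III §1.1] -/
def kdot (k : d → ℤ) : EuclideanSpace ℂ d →ₗ[ℂ] ℂ where
  toFun z := ∑ j, (k j : ℂ) * z j
  map_add' z w := by simp only [PiLp.add_apply, mul_add, Finset.sum_add_distrib]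
  map_smul' μ z := by
    simp only [PiLp.smul_apply, smul_eq_mul, RingHom.id_apply, Finset.mul_sum]
    exact Finset.sum_congr rfl fun j _ => by ring

omit [DecidableEq d] in
/-- Unfolding `kdot`. [cite: Temam1984, Ch. III §1.1] -/
theorem kdot_apply (k : d → ℤ) (z : EuclideanSpace ℂ d) : kdot k z = ∑ j, (k j : ℂ) * z j := rfl

omit [DecidableEq d] in
/-- `k · k = |k|²`. [cite: Temam1984, Ch. III §1.1] -/
theorem kdot_waveVecC (k : d → ℤ) : kdot k (waveVecC k) = (FunctionSpaces.Torus.freqNormSq k : ℂ) := by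
  rw [kdot_apply, FunctionSpaces.Torus.freqNormSq]
  push_cast
  exact Finset.sum_congr rfl fun j _ => by rw [waveVecC_apply]; ring

/-- **The transversal (Leray) projection at the wave vector `k`**: `P_k z = z − (k·z / |k|²) k`, the
orthogonal projection of `ℂ^d` onto `k^⊥ = {k · z = 0}` (for `k ≠ 0`; for `k = 0` it is the identity since
`|k|² = 0` makes the correction vanish). [cite: Temam1984, Ch. III §1.1] -/
def transversalProj (k : d → ℤ) : EuclideanSpace ℂ d →L[ℂ] EuclideanSpace ℂ d :=
  LinearMap.toContinuousLinearMap
    (LinearMap.id - ((LinearMap.lsmul ℂ (EuclideanSpace ℂ d)).flip (waveVecC k)).comp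
      (((FunctionSpaces.Torus.freqNormSq k : ℂ)⁻¹) • kdot k))

omit [DecidableEq d] in
/-- Unfolding `transversalProj`: `P_k z = z − ((k·z) / |k|²) • k`. [cite: Temam1984, Ch. III §1.1] -/
theorem transversalProj_apply (k : d → ℤ) (z : EuclideanSpace ℂ d) :
    transversalProj k z = z - ((FunctionSpaces.Torus.freqNormSq k : ℂ)⁻¹ * kdot k z) • waveVecC k := by
  simp [transversalProj]

omit [DecidableEq d] in
/-- `P_k` maps into the transversal subspace: `k · (P_k z) = 0` (`k ≠ 0`). [cite: Temam1984, Ch. III §1.1] -/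
theorem kdot_transversalProj {k : d → ℤ} (hk : k ≠ 0) (z : EuclideanSpace ℂ d) :
    kdot k (transversalProj k z) = 0 := by
  have hK : (FunctionSpaces.Torus.freqNormSq k : ℂ) ≠ 0 := by
    exact_mod_cast (freqNormSq_pos_of_ne_zero' hk).ne'
  rw [transversalProj_apply, map_sub, map_smul, kdot_waveVecC, smul_eq_mul]
  field_simp
  ring

omit [DecidableEq d] in
/-- `P_k` fixes transversal vectors: `k · z = 0 ⇒ P_k z = z`. [cite: Temam1984, Ch. III §1.1] -/
theorem transversalProj_eq_self_of_kdot_eq_zero (k : d → ℤ) {z : EuclideanSpace ℂ d} (hz : kdot k z = 0) :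
    transversalProj k z = z := by
  rw [transversalProj_apply, hz, mul_zero, zero_smul, sub_zero]

omit [DecidableEq d] in
/-- `⟪k, w⟫_ℂ = k · w` for the integer wave vector. [cite: Temam1984, Ch. III §1.1] -/
theorem inner_waveVecC_left (k : d → ℤ) (w : EuclideanSpace ℂ d) : ⟪waveVecC k, w⟫_ℂ = kdot k w := by
  rw [PiLp.inner_apply, kdot_apply]
  refine Finset.sum_congr rfl fun j _ => ?_
  rw [RCLike.inner_apply, waveVecC_apply]
  show w j * conj ((k j : ℂ)) = _
  rw [show conj ((k j : ℂ)) = (k j : ℂ) from map_intCast _ _, mul_comm]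

omit [DecidableEq d] in
/-- On transversal vectors the projection is invisible in the pairing: `k · z = 0 ⇒ ⟪z, P_k w⟫ = ⟪z, w⟫`. [cite: Temam1984, Ch. III §1.1] -/
theorem inner_transversalProj_right_of_kdot_eq_zero (k : d → ℤ) {z : EuclideanSpace ℂ d} (hz : kdot k z = 0)
    (w : EuclideanSpace ℂ d) : ⟪z, transversalProj k w⟫_ℂ = ⟪z, w⟫_ℂ := by
  rw [transversalProj_apply, inner_sub_right, inner_smul_right]
  have h : ⟪z, waveVecC k⟫_ℂ = 0 := by
    rw [← inner_conj_symm, inner_waveVecC_left, hz, map_zero]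
  rw [h, mul_zero, sub_zero]

/-- The symbol matrix `T_𝔸(k)` as a continuous `ℂ`-linear map. [cite: Frisch1995Turbulence, §9.6.3 eq. (9.57) p. 233] -/
def symbTL (𝔸 : Visc4 d) (k : d → ℤ) : EuclideanSpace ℂ d →L[ℂ] EuclideanSpace ℂ d :=
  LinearMap.toContinuousLinearMap
    { toFun := symbT 𝔸 k
      map_add' := symbT_add 𝔸 k
      map_smul' := symbT_smul 𝔸 k }

omit [DecidableEq d] in
/-- Unfolding `symbTL`. [cite: Frisch1995Turbulence, §9.6.3 eq. (9.57) p. 233] -/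
@[simp] theorem symbTL_apply (𝔸 : Visc4 d) (k : d → ℤ) (z : EuclideanSpace ℂ d) : symbTL 𝔸 k z = symbT 𝔸 k z := rfl

/-- **The modal adjoint generator** `L_k := 4π² · P_k ∘ T_𝔸(k)`: the single-mode backward adjoint problem
`∂_τ φ + 𝓛_𝔸^* φ = ∇q`, `∇·φ = 0` for `φ = Re(e_k • c(τ))` reads `c′ = L_k c` (the pressure removes the
longitudinal part of `T_𝔸(k) c`). [cite: LionsMagenes1972, Ch. 3 §4.3] [cite: Frisch1995Turbulence, §9.6.3 eq. (9.57) p. 233] -/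
def modalAdjGen (𝔸 : Visc4 d) (k : d → ℤ) : EuclideanSpace ℂ d →L[ℂ] EuclideanSpace ℂ d :=
  ((4 * Real.pi ^ 2 : ℝ) : ℂ) • (transversalProj k).comp (symbTL 𝔸 k)

omit [DecidableEq d] in
/-- Unfolding `modalAdjGen`. [cite: Frisch1995Turbulence, §9.6.3 eq. (9.57) p. 233] -/
theorem modalAdjGen_apply (𝔸 : Visc4 d) (k : d → ℤ) (z : EuclideanSpace ℂ d) :
    modalAdjGen 𝔸 k z = ((4 * Real.pi ^ 2 : ℝ) : ℂ) • transversalProj k (symbT 𝔸 k z) := rfl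

omit [DecidableEq d] in
/-- The generator maps into the transversal subspace: `k · (L_k z) = 0` (`k ≠ 0`). [cite: Temam1984, Ch. III §1.1] -/
theorem kdot_modalAdjGen (𝔸 : Visc4 d) {k : d → ℤ} (hk : k ≠ 0) (z : EuclideanSpace ℂ d) :
    kdot k (modalAdjGen 𝔸 k z) = 0 := by
  rw [modalAdjGen_apply, map_smul, kdot_transversalProj hk, smul_zero]

omit [DecidableEq d] in
/-- On transversal vectors the generator pairs like the bare symbol:
`k · z = 0 ⇒ Re⟪z, L_k z⟫ = 4π² Re⟪z, T_𝔸(k) z⟫`. [cite: Frisch1995Turbulence, §9.6.3 eq. (9.57) p. 233] -/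
theorem re_inner_modalAdjGen_self (𝔸 : Visc4 d) (k : d → ℤ) {z : EuclideanSpace ℂ d} (hz : kdot k z = 0) :
    (⟪z, modalAdjGen 𝔸 k z⟫_ℂ).re = 4 * Real.pi ^ 2 * (⟪z, symbT 𝔸 k z⟫_ℂ).re := by
  rw [modalAdjGen_apply, inner_smul_right, inner_transversalProj_right_of_kdot_eq_zero k hz, Complex.re_ofReal_mul]

/-! ## §2 The coefficient curve `c(τ) = exp((τ − t) L_k) z` -/

/-- **The modal adjoint coefficient curve** with terminal value `z` at time `t`:
`c(τ) = exp((τ − t) · L_k) z` (real time; `exp` in the Banach algebra `ℂ^d →L[ℂ] ℂ^d`). [cite: LionsMagenes1972, Ch. 3 §4.3] -/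
def modalAdjCoeff (𝔸 : Visc4 d) (k : d → ℤ) (t : ℝ) (z : EuclideanSpace ℂ d) (τ : ℝ) : EuclideanSpace ℂ d :=
  NormedSpace.exp ((τ - t) • modalAdjGen 𝔸 k) z

omit [DecidableEq d] in
/-- Terminal value: `c(t) = z`. [cite: LionsMagenes1972, Ch. 3 §4.3] -/
theorem modalAdjCoeff_self (𝔸 : Visc4 d) (k : d → ℤ) (t : ℝ) (z : EuclideanSpace ℂ d) :
    modalAdjCoeff 𝔸 k t z t = z := by
  have h0 : (t - t) • modalAdjGen 𝔸 k = 0 := by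
    rw [sub_self]; exact zero_smul ℝ (modalAdjGen 𝔸 k)
  rw [modalAdjCoeff, h0, NormedSpace.exp_zero]
  rfl

omit [DecidableEq d] in
/-- The operator curve `τ ↦ exp((τ − t) L_k)` is differentiable with derivative `exp((τ − t) L_k) ∘ L_k`. [cite: LionsMagenes1972, Ch. 3 §4.3] -/
theorem hasDerivAt_exp_sub_smul (𝔸 : Visc4 d) (k : d → ℤ) (t τ : ℝ) :
    HasDerivAt (fun σ : ℝ => NormedSpace.exp ((σ - t) • modalAdjGen 𝔸 k))
      (NormedSpace.exp ((τ - t) • modalAdjGen 𝔸 k) * modalAdjGen 𝔸 k) τ := by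
  have h := hasDerivAt_exp_smul_const (𝕂 := ℝ) (modalAdjGen 𝔸 k) (τ - t)
  have h2 : HasDerivAt (fun σ : ℝ => σ - t) 1 τ := (hasDerivAt_id τ).sub_const t
  have h3 := h.scomp τ h2
  simpa [Function.comp_def] using h3

omit [DecidableEq d] in
/-- **`c′ = L_k c`**: the coefficient curve solves the modal adjoint ODE (for every `τ`). [cite: LionsMagenes1972, Ch. 3 §4.3] -/
theorem hasDerivAt_modalAdjCoeff (𝔸 : Visc4 d) (k : d → ℤ) (t : ℝ) (z : EuclideanSpace ℂ d) (τ : ℝ) :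
    HasDerivAt (modalAdjCoeff 𝔸 k t z) (modalAdjGen 𝔸 k (modalAdjCoeff 𝔸 k t z τ)) τ := by
  have hev := ((ContinuousLinearMap.apply ℂ (EuclideanSpace ℂ d) z).restrictScalars ℝ).hasFDerivAt.comp_hasDerivAt τ
    (hasDerivAt_exp_sub_smul 𝔸 k t τ)
  have e1 : ((ContinuousLinearMap.apply ℂ (EuclideanSpace ℂ d) z).restrictScalars ℝ) ∘
      (fun σ : ℝ => NormedSpace.exp ((σ - t) • modalAdjGen 𝔸 k)) = modalAdjCoeff 𝔸 k t z := by
    funext σ; rfl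
  have e2 : ((ContinuousLinearMap.apply ℂ (EuclideanSpace ℂ d) z).restrictScalars ℝ)
      (NormedSpace.exp ((τ - t) • modalAdjGen 𝔸 k) * modalAdjGen 𝔸 k) =
      modalAdjGen 𝔸 k (modalAdjCoeff 𝔸 k t z τ) := by
    show (NormedSpace.exp ((τ - t) • modalAdjGen 𝔸 k) * modalAdjGen 𝔸 k) z = _
    have hc : Commute ((τ - t) • modalAdjGen 𝔸 k) (modalAdjGen 𝔸 k) := by
      change ((τ - t) • modalAdjGen 𝔸 k) * modalAdjGen 𝔸 k = modalAdjGen 𝔸 k * ((τ - t) • modalAdjGen 𝔸 k)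
      refine ContinuousLinearMap.ext fun w => ?_
      rw [ContinuousLinearMap.mul_def, ContinuousLinearMap.mul_def, ContinuousLinearMap.comp_apply,
        ContinuousLinearMap.comp_apply]
      show (τ - t) • modalAdjGen 𝔸 k (modalAdjGen 𝔸 k w) = modalAdjGen 𝔸 k ((τ - t) • modalAdjGen 𝔸 k w)
      rw [ContinuousLinearMap.map_smul_of_tower]
    rw [hc.exp_left.eq, modalAdjCoeff]
    rfl
  rw [e1, e2] at hev
  exact hev

omit [DecidableEq d] in
/-- The coefficient curve is differentiable in (real) time. [cite: LionsMagenes1972, Ch. 3 §4.3] -/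
theorem differentiable_modalAdjCoeff (𝔸 : Visc4 d) (k : d → ℤ) (t : ℝ) (z : EuclideanSpace ℂ d) :
    Differentiable ℝ (modalAdjCoeff 𝔸 k t z) := fun τ => (hasDerivAt_modalAdjCoeff 𝔸 k t z τ).differentiableAt

omit [DecidableEq d] in
/-- The coefficient curve is continuous. [cite: LionsMagenes1972, Ch. 3 §4.3] -/
theorem continuous_modalAdjCoeff (𝔸 : Visc4 d) (k : d → ℤ) (t : ℝ) (z : EuclideanSpace ℂ d) :
    Continuous (modalAdjCoeff 𝔸 k t z) := (differentiable_modalAdjCoeff 𝔸 k t z).continuous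

omit [DecidableEq d] in
/-- `deriv c = L_k c`. [cite: LionsMagenes1972, Ch. 3 §4.3] -/
theorem deriv_modalAdjCoeff (𝔸 : Visc4 d) (k : d → ℤ) (t : ℝ) (z : EuclideanSpace ℂ d) (τ : ℝ) :
    deriv (modalAdjCoeff 𝔸 k t z) τ = modalAdjGen 𝔸 k (modalAdjCoeff 𝔸 k t z τ) :=
  (hasDerivAt_modalAdjCoeff 𝔸 k t z τ).deriv

omit [DecidableEq d] in
/-- **Transversality is preserved**: if `k ≠ 0` and `k · z = 0` then `k · c(τ) = 0` for every `τ` (the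
generator maps into `k^⊥`, so `τ ↦ k · c(τ)` has zero derivative). [cite: Temam1984, Ch. III §1.1] -/
theorem kdot_modalAdjCoeff (𝔸 : Visc4 d) {k : d → ℤ} (hk : k ≠ 0) (t : ℝ) {z : EuclideanSpace ℂ d}
    (hz : kdot k z = 0) (τ : ℝ) : kdot k (modalAdjCoeff 𝔸 k t z τ) = 0 := by
  set f : ℝ → ℂ := fun σ => kdot k (modalAdjCoeff 𝔸 k t z σ) with hf_def
  have hf : ∀ σ, HasDerivAt f 0 σ := by
    intro σ
    have h := (((kdot k).toContinuousLinearMap).restrictScalars ℝ).hasFDerivAt.comp_hasDerivAt σ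
      (hasDerivAt_modalAdjCoeff 𝔸 k t z σ)
    have e : (((kdot k).toContinuousLinearMap).restrictScalars ℝ) (modalAdjGen 𝔸 k (modalAdjCoeff 𝔸 k t z σ)) = 0 :=
      kdot_modalAdjGen 𝔸 hk _
    rw [e] at h
    exact h
  have hconst := is_const_of_deriv_eq_zero (f := f) (fun σ => (hf σ).differentiableAt) (fun σ => (hf σ).deriv) τ t
  have ht : f t = 0 := by
    show kdot k (modalAdjCoeff 𝔸 k t z t) = 0
    rw [modalAdjCoeff_self, hz]
  have : f τ = 0 := by rw [hconst, ht]
  exact this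

omit [DecidableEq d] in
/-- **Energy derivative along the modal adjoint curve**: `d/dτ ‖c‖² = 2 Re⟪c, L_k c⟫`. [cite: LionsMagenes1972, Ch. 3 §4.3] -/
theorem hasDerivAt_norm_sq_modalAdjCoeff (𝔸 : Visc4 d) (k : d → ℤ) (t : ℝ) (z : EuclideanSpace ℂ d) (τ : ℝ) :
    HasDerivAt (fun σ => ‖modalAdjCoeff 𝔸 k t z σ‖ ^ 2)
      (2 * (⟪modalAdjCoeff 𝔸 k t z τ, modalAdjGen 𝔸 k (modalAdjCoeff 𝔸 k t z τ)⟫_ℂ).re) τ := by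
  have hc := hasDerivAt_modalAdjCoeff 𝔸 k t z τ
  have h1 := hc.inner ℂ hc
  have h2 := (Complex.reCLM.hasFDerivAt).comp_hasDerivAt τ h1
  have e1 : (⇑Complex.reCLM ∘ fun σ => ⟪modalAdjCoeff 𝔸 k t z σ, modalAdjCoeff 𝔸 k t z σ⟫_ℂ) =
      fun σ => ‖modalAdjCoeff 𝔸 k t z σ‖ ^ 2 := by
    funext σ
    simp only [Function.comp_apply, Complex.reCLM_apply]
    exact inner_self_eq_norm_sq (𝕜 := ℂ) _
  rw [e1] at h2
  refine h2.congr_deriv ?_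
  rw [Complex.reCLM_apply, Complex.add_re, ← inner_conj_symm (modalAdjCoeff 𝔸 k t z τ), Complex.conj_re]
  ring

omit [DecidableEq d] in
/-- For transversal data the energy derivative is the symbol form: `d/dτ ‖c‖² = 8π² Re⟪c, T_𝔸(k) c⟫`
(`k ≠ 0`, `k · z = 0`). [cite: Frisch1995Turbulence, §9.6.3 eq. (9.57) p. 233] -/
theorem hasDerivAt_norm_sq_modalAdjCoeff_of_kdot (𝔸 : Visc4 d) {k : d → ℤ} (hk : k ≠ 0) (t : ℝ)
    {z : EuclideanSpace ℂ d} (hz : kdot k z = 0) (τ : ℝ) :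
    HasDerivAt (fun σ => ‖modalAdjCoeff 𝔸 k t z σ‖ ^ 2)
      (8 * Real.pi ^ 2 * (⟪modalAdjCoeff 𝔸 k t z τ, symbT 𝔸 k (modalAdjCoeff 𝔸 k t z τ)⟫_ℂ).re) τ := by
  have h := hasDerivAt_norm_sq_modalAdjCoeff 𝔸 k t z τ
  rw [re_inner_modalAdjGen_self 𝔸 k (kdot_modalAdjCoeff 𝔸 hk t hz τ)] at h
  convert h using 1
  ring

omit [DecidableEq d] in
/-- In a Legendre–Hadamard window the symbol form dominates the energy on transversal vectors:
`lo · |k|² · ‖c‖² ≤ Re⟪c, T_𝔸(k) c⟫` along the curve. [cite: Frisch1995Turbulence, §9.6.3 eq. (9.57) p. 233] -/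
theorem lo_mul_norm_sq_modalAdjCoeff_le {𝔸 : Visc4 d} {lo hi : ℝ} (h𝔸 : NearIso 𝔸 lo hi) {k : d → ℤ} (hk : k ≠ 0)
    (t : ℝ) {z : EuclideanSpace ℂ d} (hz : kdot k z = 0) (τ : ℝ) :
    lo * (FunctionSpaces.Torus.freqNormSq k * ‖modalAdjCoeff 𝔸 k t z τ‖ ^ 2) ≤
      (⟪modalAdjCoeff 𝔸 k t z τ, symbT 𝔸 k (modalAdjCoeff 𝔸 k t z τ)⟫_ℂ).re :=
  lo_mul_le_re_inner_symbT h𝔸 (kdot_modalAdjCoeff 𝔸 hk t hz τ)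

omit [DecidableEq d] in
/-- **Backward energy decay of the modal adjoint curve**: for `NearIso 𝔸 lo hi` with `0 ≤ lo`, `k ≠ 0`,
`k · z = 0` and `τ ≤ t`: `‖c(τ)‖² ≤ exp(−8π²·lo·|k|²·(t − τ)) · ‖z‖²` (the adjoint problem is dissipative
backward in time; Grönwall on `e^{−κσ}‖c σ‖²`). [cite: LionsMagenes1972, Ch. 3 §4.3] -/
theorem norm_sq_modalAdjCoeff_le_exp {𝔸 : Visc4 d} {lo hi : ℝ} (h𝔸 : NearIso 𝔸 lo hi)
    {k : d → ℤ} (hk : k ≠ 0) (t : ℝ) {z : EuclideanSpace ℂ d} (hz : kdot k z = 0) {τ : ℝ} (hτ : τ ≤ t) :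
    ‖modalAdjCoeff 𝔸 k t z τ‖ ^ 2 ≤
      Real.exp (-(8 * Real.pi ^ 2 * lo * FunctionSpaces.Torus.freqNormSq k * (t - τ))) * ‖z‖ ^ 2 := by
  -- `κ := 8π² lo |k|²`; `σ ↦ e^{−κσ} ‖c σ‖²` is nondecreasing
  have hderiv : ∀ σ, HasDerivAt (fun σ => Real.exp (-(8 * Real.pi ^ 2 * lo * FunctionSpaces.Torus.freqNormSq k * σ)) *
      ‖modalAdjCoeff 𝔸 k t z σ‖ ^ 2)
      (Real.exp (-(8 * Real.pi ^ 2 * lo * FunctionSpaces.Torus.freqNormSq k * σ)) *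
        (8 * Real.pi ^ 2 * (⟪modalAdjCoeff 𝔸 k t z σ, symbT 𝔸 k (modalAdjCoeff 𝔸 k t z σ)⟫_ℂ).re -
          8 * Real.pi ^ 2 * lo * FunctionSpaces.Torus.freqNormSq k * ‖modalAdjCoeff 𝔸 k t z σ‖ ^ 2)) σ := by
    intro σ
    have h1 : HasDerivAt (fun σ => Real.exp (-(8 * Real.pi ^ 2 * lo * FunctionSpaces.Torus.freqNormSq k * σ)))
        (Real.exp (-(8 * Real.pi ^ 2 * lo * FunctionSpaces.Torus.freqNormSq k * σ)) *
          (-(8 * Real.pi ^ 2 * lo * FunctionSpaces.Torus.freqNormSq k))) σ := by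
      have := ((hasDerivAt_id σ).const_mul (8 * Real.pi ^ 2 * lo * FunctionSpaces.Torus.freqNormSq k)).neg.exp
      simpa using this
    have h2 := hasDerivAt_norm_sq_modalAdjCoeff_of_kdot 𝔸 hk t hz σ
    refine (h1.mul h2).congr_deriv ?_
    ring
  have hmono : Monotone (fun σ => Real.exp (-(8 * Real.pi ^ 2 * lo * FunctionSpaces.Torus.freqNormSq k * σ)) *
      ‖modalAdjCoeff 𝔸 k t z σ‖ ^ 2) := by
    refine monotone_of_deriv_nonneg (fun σ => (hderiv σ).differentiableAt) fun σ => ?_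
    rw [(hderiv σ).deriv]
    refine mul_nonneg (Real.exp_nonneg _) ?_
    have hlow := lo_mul_norm_sq_modalAdjCoeff_le h𝔸 hk t hz σ
    nlinarith [Real.pi_pos, sq_nonneg Real.pi]
  have hτt := hmono hτ
  simp only [modalAdjCoeff_self] at hτt
  have hpos : 0 < Real.exp (-(8 * Real.pi ^ 2 * lo * FunctionSpaces.Torus.freqNormSq k * τ)) := Real.exp_pos _
  have e : Real.exp (-(8 * Real.pi ^ 2 * lo * FunctionSpaces.Torus.freqNormSq k * (t - τ))) =
      Real.exp (-(8 * Real.pi ^ 2 * lo * FunctionSpaces.Torus.freqNormSq k * t)) /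
        Real.exp (-(8 * Real.pi ^ 2 * lo * FunctionSpaces.Torus.freqNormSq k * τ)) := by
    rw [← Real.exp_sub]; congr 1; ring
  rw [e, div_mul_eq_mul_div, le_div_iff₀ hpos]
  linarith

omit [DecidableEq d] in
/-- Corollary: `‖c(τ)‖ ≤ ‖z‖` for `τ ≤ t` (dissipativity backward in time). [cite: LionsMagenes1972, Ch. 3 §4.3] -/
theorem norm_modalAdjCoeff_le {𝔸 : Visc4 d} {lo hi : ℝ} (h𝔸 : NearIso 𝔸 lo hi) (hlo : 0 ≤ lo)
    {k : d → ℤ} (hk : k ≠ 0) (t : ℝ) {z : EuclideanSpace ℂ d} (hz : kdot k z = 0) {τ : ℝ} (hτ : τ ≤ t) :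
    ‖modalAdjCoeff 𝔸 k t z τ‖ ≤ ‖z‖ := by
  have h := norm_sq_modalAdjCoeff_le_exp h𝔸 hk t hz hτ
  have hexp : Real.exp (-(8 * Real.pi ^ 2 * lo * FunctionSpaces.Torus.freqNormSq k * (t - τ))) ≤ 1 := by
    rw [Real.exp_le_one_iff, neg_nonpos]
    have : 0 ≤ FunctionSpaces.Torus.freqNormSq k := (freqNormSq_pos_of_ne_zero' hk).le
    have : 0 ≤ t - τ := by linarith
    positivity
  have h2 : ‖modalAdjCoeff 𝔸 k t z τ‖ ^ 2 ≤ ‖z‖ ^ 2 :=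
    h.trans ((mul_le_of_le_one_left (sq_nonneg _) hexp))
  have h3 := Real.sqrt_le_sqrt h2
  rwa [Real.sqrt_sq (norm_nonneg _), Real.sqrt_sq (norm_nonneg _)] at h3

omit [DecidableEq d] in
/-- **The dissipation identity** of the modal adjoint curve (transversal data, `k ≠ 0`):
`‖c t‖² − ‖c τ₀‖² = ∫_{τ₀}^{t} 8π² Re⟪c, T_𝔸(k) c⟫`. [cite: LionsMagenes1972, Ch. 3 §4.3] -/
theorem norm_sq_sub_eq_integral_modalAdjCoeff (𝔸 : Visc4 d) {k : d → ℤ} (hk : k ≠ 0) (t : ℝ)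
    {z : EuclideanSpace ℂ d} (hz : kdot k z = 0) (τ₀ : ℝ) :
    ‖z‖ ^ 2 - ‖modalAdjCoeff 𝔸 k t z τ₀‖ ^ 2 =
      ∫ σ in τ₀..t, 8 * Real.pi ^ 2 * (⟪modalAdjCoeff 𝔸 k t z σ, symbT 𝔸 k (modalAdjCoeff 𝔸 k t z σ)⟫_ℂ).re := by
  have hcont : Continuous fun σ => 8 * Real.pi ^ 2 *
      (⟪modalAdjCoeff 𝔸 k t z σ, symbT 𝔸 k (modalAdjCoeff 𝔸 k t z σ)⟫_ℂ).re := by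
    refine continuous_const.mul (Complex.continuous_re.comp ?_)
    exact (continuous_modalAdjCoeff 𝔸 k t z).inner ((symbTL 𝔸 k).continuous.comp (continuous_modalAdjCoeff 𝔸 k t z))
  have h := intervalIntegral.integral_eq_sub_of_hasDerivAt (a := τ₀) (b := t)
    (fun σ _ => hasDerivAt_norm_sq_modalAdjCoeff_of_kdot 𝔸 hk t hz σ) (hcont.intervalIntegrable _ _)
  rw [h, modalAdjCoeff_self]

omit [DecidableEq d] in
/-- **The dissipation budget**: in a window `NearIso 𝔸 lo hi`, for transversal data and `τ₀ ≤ t`,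
`8π² · lo · |k|² · ∫_{τ₀}^{t} ‖c‖² ≤ ‖z‖² − ‖c τ₀‖² ≤ ‖z‖²`. [cite: LionsMagenes1972, Ch. 3 §4.3] -/
theorem integral_norm_sq_modalAdjCoeff_le {𝔸 : Visc4 d} {lo hi : ℝ} (h𝔸 : NearIso 𝔸 lo hi)
    {k : d → ℤ} (hk : k ≠ 0) (t : ℝ) {z : EuclideanSpace ℂ d} (hz : kdot k z = 0) {τ₀ : ℝ} (hτ₀ : τ₀ ≤ t) :
    8 * Real.pi ^ 2 * lo * FunctionSpaces.Torus.freqNormSq k * ∫ σ in τ₀..t, ‖modalAdjCoeff 𝔸 k t z σ‖ ^ 2 ≤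
      ‖z‖ ^ 2 - ‖modalAdjCoeff 𝔸 k t z τ₀‖ ^ 2 := by
  rw [norm_sq_sub_eq_integral_modalAdjCoeff 𝔸 hk t hz τ₀, ← intervalIntegral.integral_const_mul]
  refine intervalIntegral.integral_mono_on hτ₀ ?_ ?_ fun σ _ => ?_
  · exact ((continuous_modalAdjCoeff 𝔸 k t z).norm.pow 2 |>.const_mul _).intervalIntegrable _ _
  · refine (continuous_const.mul (Complex.continuous_re.comp ?_)).intervalIntegrable _ _
    exact (continuous_modalAdjCoeff 𝔸 k t z).inner ((symbTL 𝔸 k).continuous.comp (continuous_modalAdjCoeff 𝔸 k t z))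
  · have := lo_mul_norm_sq_modalAdjCoeff_le h𝔸 hk t hz σ
    nlinarith [Real.pi_pos, sq_nonneg Real.pi]

end Torus

end Literature.Analysis.FluidPDE

end
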